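import Summits.SmoothPoincare4.SmoothPoincare4.Theses.AngleDefectCertificates
import Literature.Topology.FourManifolds.HomotopyS4CompactProofs
import HarnessLib

/-!
# Line `birth` — BC3 skeleton for the crux `AngleDefectCertificates.CertifiedSpheresExist` (stmt-SmoothPoincare4-11223)

Route `route-SmoothPoincare4-AngleDefectCertificates` (rev 7), decl
`Summit.SmoothPoincare4.SmoothPoincare4.Theses.AngleDefectCertificates.CertifiedSpheresExist` = EX,
the route's TARGET (rank 0, auto-cruxed 2026-08-16 as the underived hypothesis `hEx` of `closes`):

  every smooth homotopy 4-sphere `M` (Hausdorff, second countable, `C^∞` atlas on `ℝ⁴`, `M ≃ₕ S⁴` —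
  the bare carriers of `SmoothPoincare4`) admits an ANGLE-DEFECT CERTIFICATE: a finite Euclidean
  simplicial complex `K ⊂ ℝᴺ`, pure of dimension 4, a homeomorphism `|K| ≃ₜ M` that is a `C^∞`
  immersion on every closed simplex (a Whitehead triangulation of THIS smooth structure), and a
  symmetric unit-diagonal cosine function `c` making every 4-face a non-degenerate spherical
  simplex (5×5 Gram matrix positive definite) with NO ANGLE EXCESS (spherical dihedral angles
  around every triangle sum to `≤ 2π`), i.e. `|K|` with the glued piecewise-spherical metric is a
  spherical polyhedral space of curvature `≥ 1` in Alexandrov's sense.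

Standing of the crux (item notes 2026-08-15, grounder g18-7 / refuters g43-4, g44-45, g44-48, g44-52):
checked, open, "⇔ SPC4 given REC_sc"; `SmoothPoincare4 → CertifiedSpheresExist` (transport the round
certificate `RoundSphereCertificate`, item 7227) is the trivial direction.  No `Disproof.lean`, no
crux workfiles, no landed `Theorems/CertifiedSpheresExist/Negative/*` (`ledger crux ls
stmt-SmoothPoincare4-11223`: none, 2026-08-17); `ledger negatives --problem SmoothPoincare4` has no
polyhedral / curvature-operator entry.

## The line: Petrunin approximation — a certificate is exactly what a metric of positive curvature operator leaves behind

A certificate is a spherical polyhedral CBB(1) metric on `M`, compatible with its smooth structure.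
The route's recognition crux REC (`PolyhedralPCORecognition`, support; `PolyhedralSphereRecognition`,
rank 2) SMOOTHS a certificate to a `C^∞` metric of positive curvature operator (PCO).  The CONVERSE
— which Riemannian manifolds are Lipschitz limits of `κ`-polyhedral spaces with curvature `≥ κ` — is
SETTLED IN PRINT: Petrunin 2003 (*Polyhedral approximations of Riemannian manifolds*, Turkish J. Math.
27, arXiv:2207.07559), Thm. 2 (Global theorem: `cosec M ≥ κ + ε` and a stably trivial tangent bundle of
`M` or of a finite cover ⇒ `M` is a Lipschitz limit of `m`-dimensional `κ`-polyhedral metrics with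
curvature `≥ κ`) and Cor. 3 (`κ = 1`: a complete Riemannian manifold is such a limit of spherical
polyhedral metrics with curvature `≥ 1` iff `cosec M ≥ 1`); and in dimension 4 the cone of curvature
tensors of non-negative COSECTIONAL curvature is the cone of non-negative CURVATURE OPERATOR (Petrunin
2003 §1.E; Lebedeva–Matveev–Petrunin–Shevchishin arXiv:1411.0307, p. 1: "in dimension 4 nonnegative
cosectional curvature has the same meaning as nonnegative curvature operator").  So the crux splits as

  `CertifiedSpheresExist ⇐ PcoOnHomotopySpheres ∧ CertificateOfPCO`,

one OPEN existence leaf carrying the summit's weight and one KNOWN (deep) approximation leaf carrying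
the polyhedral geometry — the same shape as the existence/recognition splits of the curvature routes
RicciFat / EntropyRung / PIC, and as the registered skeleton of `BachCriticalElement.PscOnHomotopySpheres`:

* `stub_pcoOnHomotopySpheres` — **OPEN (the bet; summit-strength, as the crux itself is):** every
  smooth homotopy 4-sphere `M` carries a `C^∞` Riemannian metric `g` with positive curvature operator
  (`g.IsRiemannian ∧ g.HasPositiveCurvatureOperator`, Hamilton 1986 p. 153, the tree's
  `Literature/Geometry/Riemannian/CurvatureOperator.lean`; the phrase is VERBATIM the hypothesis of the
  named fact `Literature.Geometry.Riemannian.hamilton_positiveCurvatureOperator_classification_four` and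
  the conclusion of the route's `PolyhedralPCORecognition`).  `SmoothPoincare4 ⇒` stub (pull back the
  round metric, whose curvature operator is the identity); stub `⇒ SmoothPoincare4` by Hamilton 1986
  Thm. 1.1 (compact simply connected PCO 4-manifold `≅ S⁴`; in tree only as the UNPROVED named fact
  above, with the simply connected corollary `hamilton_positiveCurvatureOperator_sphere_four_of_classification`
  derived from it) — so the stub is equivalent to the summit by a deep theorem, never cheaply (BC3
  probes below), exactly as EX is "⇔ SPC4 given REC_sc".  Why it might fail: it fails iff an exotic
  homotopy 4-sphere exists (`¬SmoothPoincare4`), which then carries no PCO metric (Hamilton) — the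
  route's own kill criterion for EX.  Sources: Hamilton1986 (Thm. 1.1), BohmWilking2008, FreedmanGompfMorrisonWalker2010.
  Size: open problem.
* `stub_certificateOfPCO` — **KNOWN in print, deep (Petrunin 2003 Thm. 2 + Cor. 3 with `κ = 1`, `m = 4`;
  XL to formalise):** a COMPACT Hausdorff second-countable smooth 4-manifold carrying a `C^∞` Riemannian
  metric of positive curvature operator admits an angle-defect certificate for the same smooth structure.
  Proof in print: compactness gives curvature operator `≥ λ₀ > 0`; rescale to curvature operator
  `≥ 1 + ε`, i.e. `cosec ≥ 1 + ε` in dimension 4; the tangent-bundle proviso of Thm. 2 holds for the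
  universal cover (a compact simply connected PCO 4-manifold is a real homology sphere by Bochner–
  Gallot–Meyer, hence a homotopy 4-sphere, hence stably parallelisable — or invoke Hamilton 1986 /
  Böhm–Wilking: the cover is `S⁴`); Petrunin's approximants are spherical polyhedral 4-manifolds
  `P ⊂ S^q` cut out near the isometrically embedded `M` by polyhedral approximations of locally convex
  hypersurfaces (§2 of the paper), CBB(1) (cone angles `≤ 2π`), with nearest-point projection `P → M` a
  bi-Lipschitz homeomorphism smooth on each closed simplex (hence an immersion there); PACKAGING into the
  certificate format: `K :=` the flat simplices on the same vertex sets (a Euclidean complex in `ℝ^{q+1}`,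
  radially homeomorphic to `P`), `h :=` projection ∘ radial map, `c(a,b) := ⟨a,b⟩` (Gram matrices of
  non-degenerate spherical simplices are positive definite; the dihedral-angle sums of the certificate are
  the cone angles of `P`).  ALTERNATIVE proof in print: Hamilton 1986 Thm. 1.1 (each component is `S⁴` or
  `ℝP⁴`) + the explicit certificates `∂Δ⁵ → S⁴` (item `RoundSphereCertificate`, 7227) and
  `sd ∂β₅ / ±1 → ℝP⁴` (barycentric subdivision of the 5-cross-polytope boundary realised geodesically on the
  round `S⁴`: cone angles exactly `2π`, antipodal action regular, quotient simplicial) + transport of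
  certificates along diffeomorphisms.  Degenerate cases: `M = ∅` (complex with no faces) and disconnected
  `M` (finitely many components, complexes in orthogonal blocks) hold.  The statement is the CONVERSE of the
  route's support item `PolyhedralPCORecognition` (same binders, `[CompactSpace M]` added — a certified
  `M` is compact, a PCO one need not be), so with REC it upgrades the route's dictionary to an
  equivalence "closed smooth 4-manifold admits a certificate ⇔ admits a PCO metric".  Why it might fail:
  it does not (published theorem); risks are formalisation size (isometric embeddings with positive
  `Φ`-curvature [Gromov PDR], polyhedral approximation of convex hypersurfaces, Alexandrov geometry of
  polyhedra, Whitehead packaging).  Sources: Petrunin2003 (arXiv:2207.07559, Thm. 2, Cor. 3, §1.E, §2),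
  ShevchishinEtAl2015 (arXiv:1411.0307), AlexanderKapovitchPetrunin2024, BuragoGromovPerelman1992, Hamilton1986.
* `CertifiedSpheresExist_of : <stub₁-sig> → <stub₂-sig> → CertifiedSpheresExist` — THE skeleton
  theorem, a REAL proof (no `sorry`): for `M ≃ₕ S⁴`, `M` is compact
  (`Literature.Topology.FourManifolds.compactSpace_of_homotopyEquiv_sphere_four_holds`, PROVED in tree,
  Hatcher Prop. 3.29), stub 1 gives the PCO metric, stub 2 the certificate.  Axioms
  {propext, Classical.choice, Quot.sound}.
* `CertifiedSpheresExist_of_stubs : CertifiedSpheresExist` — the same, fed with the two declared stubs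
  (the only `sorry`s of the file), so that the crux BY NAME depends on exactly `stub_*`.

What this line adds to the route (a finding for the tenure planner): the route header's sentence
"PCO metrics are not known to admit CBB(1) polyhedral approximations" (rationale of
`PolyhedralSphereRecognition`) is OUTDATED — Petrunin 2003 Thm. 2 / Cor. 3 is exactly that
approximation theorem (modulo the tangent-bundle proviso, automatic on homotopy spheres).  Consequences:
(i) EX ⇔ `PcoOnHomotopySpheres` given stub 2 (known) one way and REC the other, so the certificate
format loses NOTHING against positive curvature operator — the route's thesis becomes
"SPC4 ⇔ every homotopy 4-sphere is certifiable ⇔ every homotopy 4-sphere is PCO", with the certificate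
side FINITE and searchable; (ii) REC_sc + stub 2 ⊇ Hamilton's theorem on homotopy spheres (a PCO homotopy
sphere is certifiable, hence `S⁴` by REC_sc), so REC_sc is at least as strong as Hamilton 1986 restricted to
`π₁ = 1` — consistent with its `difficulty: open-problem` tag, and a reason to expect its proof to CONTAIN a
Ricci-flow classification step (as the route's two-layer plan already foresees).

BC3 probes (planner folder `bc/probe_stub{1,2}_{crux,summit}.lean`, 2026-08-17, farm `lean check`,
`maxHeartbeats 400000` per attempt): for each stub, `stub → CertifiedSpheresExist` and
`stub → SmoothPoincare4` by each of `exact?`, `simpa`, `aesop`, `aesop (config := { enableSimp := false })`,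
`simpa [<target unfolded>]`, `intro; unfold <target>; exact?`, `intro; unfold <target>; aesop (noSimp)` —
ALL 28 ATTEMPTS FAIL (`exact?` "could not close the goal"; `simpa` "assumption failed" / heartbeat
timeout; `aesop` "failed to prove the goal after exhaustive search" / simp-normalisation timeout /
rule-application cap), while the sanity file (`stub_i → True`) elaborates rc 0: stub 1 never mentions a
triangulation, stub 2 never mentions a homotopy sphere, and no landed theorem links either to the crux or
the summit (the only bridge, Hamilton 1986, is an unproved named fact not imported by the route file).
Converse directions for the record: `CertifiedSpheresExist → stub 1` needs REC (open);
`CertifiedSpheresExist → stub 2` is no implication at all (stub 2 quantifies over all compact PCO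
4-manifolds); `SmoothPoincare4 → stub 1` is true (round metric) but not cheap; `SmoothPoincare4 → stub 2`:
stub 2 is a theorem.  Disproof used: none exists for this crux.  Negatives index: no refuted statement
about polyhedral metrics, curvature operator or certificates — neither stub instantiates a refuted statement.
-/

noncomputable section

open scoped Manifold ContDiff Topology ContinuousMap BigOperators Matrix
open Summit.SmoothPoincare4.SmoothPoincare4.Theses.AngleDefectCertificates (CertifiedSpheresExist)

-- `Summit.<Summit>.<Problem>`: for the single-conjunct summit the duplicate segment is mandated.
set_option linter.dupNamespace false
set_option linter.unusedVariables false

namespace Summit.SmoothPoincare4.SmoothPoincare4.Cruxes.CertifiedSpheresExist.Birth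

/-! ## The two registered stubs (`sorry` lives ONLY here) -/

/-- **Stub 1 (OPEN — the bet; summit-strength): every smooth homotopy 4-sphere carries a `C^∞`
Riemannian metric with positive curvature operator.**  Binders = the summit's (`M : Type`, Hausdorff,
second countable, `C^∞` atlas on `ℝ⁴`, `M ≃ₕ S⁴`); conclusion = VERBATIM the hypothesis of the named
fact `Literature.Geometry.Riemannian.hamilton_positiveCurvatureOperator_classification_four` and the
conclusion of the route's `PolyhedralPCORecognition` (`g.HasPositiveCurvatureOperator`: `Rm(φ, φ) > 0`
for every 2-vector `φ ≠ 0`, for every Levi-Civita connection of `g`; Hamilton 1986, p. 153).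
`SmoothPoincare4 ⇒` stub: pull back the round metric of `S⁴ ⊂ ℝ⁵` (curvature operator = identity).
Stub `⇒ SmoothPoincare4`: Hamilton 1986 Thm. 1.1 (a compact PCO 4-manifold is `S⁴` or `ℝP⁴`; `M` is
compact and simply connected), in tree only as the unproved named fact — equivalent to the summit by a
deep theorem, not cheaply (BC3 probes: 14/14 attempts fail).  Why it might fail: iff an exotic homotopy
4-sphere exists; it then carries no PCO metric (Hamilton), and EX dies with it by REC — the route's kill
criterion.  [cite: Hamilton1986, §1, Thm. 1.1 (p. 153)] [cite: BohmWilking2008]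
[cite: FreedmanGompfMorrisonWalker2010, Conj. 1.1] -/
theorem stub_pcoOnHomotopySpheres :
    ∀ (M : Type) [TopologicalSpace M] [T2Space M] [SecondCountableTopology M] [ChartedSpace (EuclideanSpace ℝ (Fin 4)) M] [IsManifold (𝓡 4) ∞ M], M ≃ₕ Metric.sphere (0 : EuclideanSpace ℝ (Fin 5)) 1 → ∃ g : Literature.Geometry.Lorentzian.PseudoRiemannianMetric (𝓡 4) ∞ (EuclideanSpace ℝ (Fin 4)) (TangentSpace (𝓡 4) : M → Type _), g.IsRiemannian ∧ g.HasPositiveCurvatureOperator := by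
  sorry

/-- **Stub 2 (KNOWN in print, deep — Petrunin's polyhedral approximation theorem, `κ = 1`, `m = 4`):
a compact smooth 4-manifold with a metric of positive curvature operator admits an angle-defect
certificate for the same smooth structure.**  If `M` (Hausdorff, second countable, `C^∞` atlas on `ℝ⁴`,
COMPACT) carries a `C^∞` Riemannian metric `g` with positive curvature operator, then there are a finite
Euclidean simplicial complex `K ⊂ ℝᴺ` pure of dimension 4, a homeomorphism `|K| ≃ₜ M` that is a `C^∞`
immersion on every closed simplex, and symmetric unit-diagonal cosines `c` with every 4-face Gram matrix
positive definite and every triangle's spherical dihedral-angle sum `≤ 2π` (the certificate clause of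
`CertifiedSpheresExist`, verbatim).  Proof in print: compactness ⇒ curvature operator `≥ λ₀ > 0`;
rescale to `≥ 1 + ε`; in dimension 4 this is `cosec ≥ 1 + ε` (Petrunin 2003 §1.E; arXiv:1411.0307
p. 1); the universal cover is a homotopy 4-sphere (Myers + Bochner–Gallot–Meyer, or Hamilton 1986), so
its tangent bundle is stably trivial; Petrunin 2003 Thm. 2 / Cor. 3 then give spherical polyhedral
CBB(1) 4-manifolds `P ⊂ S^q` Lipschitz-converging to `M`, nearest-point projection being a bi-Lipschitz
homeomorphism smooth on closed simplices; package: `K` = the flat simplices on the same vertices,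
`h` = projection ∘ radial map, `c(a, b) = ⟨a, b⟩` (cone angles of `P` = the certificate's dihedral-angle
sums).  Alternative proof in print: Hamilton 1986 Thm. 1.1 (components are `S⁴` or `ℝP⁴`) + explicit
certificates `∂Δ⁵ → S⁴` (item `RoundSphereCertificate`) and `sd ∂β₅/±1 → ℝP⁴` + transport along
diffeomorphisms.  `M = ∅` and disconnected `M` hold (empty complex; orthogonal blocks).  This is the
CONVERSE of the route's support item `PolyhedralPCORecognition` (same binders + `[CompactSpace M]`).
Why it might fail: published theorem — formalisation size only (XL: isometric embedding with positive
`Φ`-curvature, polyhedral approximation of convex hypersurfaces, Alexandrov geometry of polyhedra,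
Whitehead packaging).  [cite: Petrunin2003, Thm. 2, Cor. 3, §1.E, §2 (arXiv:2207.07559)]
[cite: ShevchishinEtAl2015, p. 1 (arXiv:1411.0307)] [cite: AlexanderKapovitchPetrunin2024]
[cite: BuragoGromovPerelman1992] [cite: Hamilton1986, §1, Thm. 1.1] -/
theorem stub_certificateOfPCO :
    ∀ (M : Type) [TopologicalSpace M] [T2Space M] [SecondCountableTopology M] [ChartedSpace (EuclideanSpace ℝ (Fin 4)) M] [IsManifold (𝓡 4) ∞ M] [CompactSpace M], (∃ g : Literature.Geometry.Lorentzian.PseudoRiemannianMetric (𝓡 4) ∞ (EuclideanSpace ℝ (Fin 4)) (TangentSpace (𝓡 4) : M → Type _), g.IsRiemannian ∧ g.HasPositiveCurvatureOperator) → (∃ (N : ℕ) (K : Geometry.SimplicialComplex ℝ (EuclideanSpace ℝ (Fin N))) (h : K.space ≃ₜ M) (c : EuclideanSpace ℝ (Fin N) → EuclideanSpace ℝ (Fin N) → ℝ), K.faces.Finite ∧ (∀ s ∈ K.faces, ∃ σ ∈ K.faces, s ⊆ σ ∧ σ.card = 5) ∧ (∀ s ∈ K.faces, ∃ (g : EuclideanSpace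 ℝ (Fin N) → M) (u : Set (EuclideanSpace ℝ (Fin N))), IsOpen u ∧ convexHull ℝ (s : Set (EuclideanSpace ℝ (Fin N))) ⊆ u ∧ ContMDiffOn 𝓘(ℝ, EuclideanSpace ℝ (Fin N)) (𝓡 4) ∞ g u ∧ (∀ y : K.space, (y : EuclideanSpace ℝ (Fin N)) ∈ convexHull ℝ (s : Set (EuclideanSpace ℝ (Fin N))) → h y = g y) ∧ ∀ x ∈ convexHull ℝ (s : Set (EuclideanSpace ℝ (Fin N))), Set.InjOn (mfderiv 𝓘(ℝ, EuclideanSpace ℝ (Fin N)) (𝓡 4) g x) (vectorSpan ℝ (s : Set (EuclideanSpace ℝ (Fin N))) : Set (EuclideanSpace ℝ (Fin N)))) ∧ (∀ a b, c a b = c b a) ∧ (∀ a, c a a = 1) ∧ (∀ σ ∈ K.faces, σ.card = 5 → (Matrix.of fun a b : σ => c a b).PosDef) ∧ (∀ t ∈ K.faces, t.card = 3 → ∑ᶠ σ ∈ {σ : Finset (EuclideanSpace ℝ (Fin N)) | σ ∈ K.faces ∧ t ⊆ σ ∧ σ.card = 5}, (∑ a : σ, ∑ b : σ, if (a : EuclideanSpace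 ℝ (Fin N)) ∉ t ∧ (b : EuclideanSpace ℝ (Fin N)) ∉ t ∧ a ≠ b then Real.arccos (-((Matrix.of fun a b : σ => c a b)⁻¹ a b / Real.sqrt ((Matrix.of fun a b : σ => c a b)⁻¹ a a * (Matrix.of fun a b : σ => c a b)⁻¹ b b))) / 2 else 0) ≤ 2 * Real.pi)) := by
  sorry

/-! ## The composition: the two stubs prove the crux BY NAME (no `sorry` below this line) -/

/-- **THE SKELETON THEOREM** (BC3 shape `stub₁-sig → stub₂-sig → crux`): the crux
`Summit.SmoothPoincare4.SmoothPoincare4.Theses.AngleDefectCertificates.CertifiedSpheresExist`, concluded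
BY NAME from the two stub STATEMENTS as explicit hypotheses, by a real proof: a homotopy 4-sphere is
compact (`compactSpace_of_homotopyEquiv_sphere_four_holds`, proved in tree — Hatcher Prop. 3.29:
a non-compact connected 4-manifold has `H₄ = 0 ≠ H₄(S⁴)`), carries a PCO metric by the first
hypothesis, and is therefore certified by the second.  Axioms {propext, Classical.choice, Quot.sound}.
[cite: Petrunin2003, Thm. 2] [cite: HatcherAT2002, Prop. 3.29] -/
theorem CertifiedSpheresExist_of
    (hPco : ∀ (M : Type) [TopologicalSpace M] [T2Space M] [SecondCountableTopology M] [ChartedSpace (EuclideanSpace ℝ (Fin 4)) M] [IsManifold (𝓡 4) ∞ M], M ≃ₕ Metric.sphere (0 : EuclideanSpace ℝ (Fin 5)) 1 → ∃ g : Literature.Geometry.Lorentzian.PseudoRiemannianMetric (𝓡 4) ∞ (EuclideanSpace ℝ (Fin 4)) (TangentSpace (𝓡 4) : M → Type _), g.IsRiemannian ∧ g.HasPositiveCurvatureOperator)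
    (hCert : ∀ (M : Type) [TopologicalSpace M] [T2Space M] [SecondCountableTopology M] [ChartedSpace (EuclideanSpace ℝ (Fin 4)) M] [IsManifold (𝓡 4) ∞ M] [CompactSpace M], (∃ g : Literature.Geometry.Lorentzian.PseudoRiemannianMetric (𝓡 4) ∞ (EuclideanSpace ℝ (Fin 4)) (TangentSpace (𝓡 4) : M → Type _), g.IsRiemannian ∧ g.HasPositiveCurvatureOperator) → (∃ (N : ℕ) (K : Geometry.SimplicialComplex ℝ (EuclideanSpace ℝ (Fin N))) (h : K.space ≃ₜ M) (c : EuclideanSpace ℝ (Fin N) → EuclideanSpace ℝ (Fin N) → ℝ), K.faces.Finite ∧ (∀ s ∈ K.faces, ∃ σ ∈ K.faces, s ⊆ σ ∧ σ.card = 5) ∧ (∀ s ∈ K.faces, ∃ (g : EuclideanSpace ℝ (Fin N) → M) (u : Set (EuclideanSpace ℝ (Fin N))), IsOpen u ∧ convexHull ℝ (s : Set (EuclideanSpace ℝ (Fin N))) ⊆ u ∧ ContMDiffOn 𝓘(ℝ, EuclideanSpace ℝ (Fin N)) (𝓡 4) ∞ g u ∧ (∀ y : K.space, (y : EuclideanSpace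 ℝ (Fin N)) ∈ convexHull ℝ (s : Set (EuclideanSpace ℝ (Fin N))) → h y = g y) ∧ ∀ x ∈ convexHull ℝ (s : Set (EuclideanSpace ℝ (Fin N))), Set.InjOn (mfderiv 𝓘(ℝ, EuclideanSpace ℝ (Fin N)) (𝓡 4) g x) (vectorSpan ℝ (s : Set (EuclideanSpace ℝ (Fin N))) : Set (EuclideanSpace ℝ (Fin N)))) ∧ (∀ a b, c a b = c b a) ∧ (∀ a, c a a = 1) ∧ (∀ σ ∈ K.faces, σ.card = 5 → (Matrix.of fun a b : σ => c a b).PosDef) ∧ (∀ t ∈ K.faces, t.card = 3 → ∑ᶠ σ ∈ {σ : Finset (EuclideanSpace ℝ (Fin N)) | σ ∈ K.faces ∧ t ⊆ σ ∧ σ.card = 5}, (∑ a : σ, ∑ b : σ, if (a : EuclideanSpace ℝ (Fin N)) ∉ t ∧ (b : EuclideanSpace ℝ (Fin N)) ∉ t ∧ a ≠ b then Real.arccos (-((Matrix.of fun a b : σ => c a b)⁻¹ a b / Real.sqrt ((Matrix.of fun a b : σ => c a b)⁻¹ a a * (Matrix.of fun a b : σ => c a b)⁻¹ b b))) / 2 else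 0) ≤ 2 * Real.pi))) :
    CertifiedSpheresExist := by
  intro M _ _ _ _ _ e
  -- `M ≃ₕ S⁴` is compact (proved Literature fact, Hatcher Prop. 3.29)
  haveI : CompactSpace M :=
    Literature.Topology.FourManifolds.compactSpace_of_homotopyEquiv_sphere_four_holds M e
  -- stub 1: a PCO metric on `M`; stub 2: Petrunin approximation packages it into a certificate
  exact hCert M (hPco M e)

/-- The crux BY NAME from the two DECLARED stubs `stub_pcoOnHomotopySpheres`, `stub_certificateOfPCO`
(the only `sorry`s of this file), through `CertifiedSpheresExist_of`. [cite: Petrunin2003, Thm. 2] -/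
theorem CertifiedSpheresExist_of_stubs : CertifiedSpheresExist :=
  CertifiedSpheresExist_of stub_pcoOnHomotopySpheres stub_certificateOfPCO

end Summit.SmoothPoincare4.SmoothPoincare4.Cruxes.CertifiedSpheresExist.Birth

end
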